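import Summits.Parity.GeneralizedHardyLittlewood.Theorems.BeyondDiagonalBeatsQuarter.OffDiagCoreWinFactor
import Summits.Parity.GeneralizedHardyLittlewood.Theorems.BeyondDiagonalBeatsQuarter.OffDiagLevelLargeSieve
import HarnessLib

/-!
# Route `PrimeLevelFamEdge`, crux K_B (stmt-Parity-20343), line `diagonal_kernel_split` rev 4, plan Ω,
# node **L7d part 2, leaf S₃ — one member's `levelLargePart` SEPARATED: completion index `k`, trinomial index `e`,
# and a universal twisted level weight against the box transform** (L7D-PLAN rev 5 §5 (3)–(4))

For a member `x = (cell, h₁, s)` of the windowed FL-family (S₁ `coreWin_largeKernel_eq_levelLargePart`) and a block of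
prime levels `Q ⊆ [1, P−1]`, `q ≥ 40`, `q > |h₁|` on `Q`, the factorisation S₂ (`window_coreLevelWeight_eq_factored`), the
convex completion C (`sum_ite_convex_eq_completed`) and the linearity of `levelLargePart` in the level weight give

  `levelLargePart R Q (q ↦ 𝟙[window_x q]·coreLevelWeight D (coreHeight ε₀) Δ′ x q) n_x a_x
     = E_x · Σ_{k<P} convexCoeff(p_x) P k · Σ_{e∈3×3} t_{e₁}(l)t_{e₂}(m) ·
         levelLargePart R Q (q ↦ e(kq/P)·(2q̂(q)2π/q)·u(q)^{e₁+e₂}·Φ̂_{q,x}) n_x a_x`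

(**`levelLargePart_window_eq_separated`**): the member now enters only through the level-FREE scalars `E_x`,
`convexCoeff(p_x) P k` (majorant `2·sepWeight P k`, C) and `t(l)t(m)`, and through the box transform `Φ̂_{q,x}` — whose
level dependence is separated on the unit box by prover-8's `sum_mul_fourier2_boxWeight_cell_eq_unitBox` +
`levelFactor_separation_box` (next leaf). Tools: `levelLargePart_congr`, `ite_one_convex_eq_sum`, `levelLargePart_ite_one_mul_convex`.

Pure algebra of finite sums; standard axioms. Helper toward `stub_offDiagBelowSlack_io`; closes nothing.
«The programme SEARCHES and TYPES; no claim about Landau–Siegel zeros, Theorems 1–2 of arXiv:2211.02515 or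
a repaired Margin232 until a kernel theorem says so.»
-/

noncomputable section

open Finset Real Polynomial

namespace Summit.Parity.GeneralizedHardyLittlewood.Theorems.BeyondDiagonalBeatsQuarter.OffDiag

open Literature.NumberTheory.LFunctions Literature.NumberTheory.LFunctions.KMV2000
open Literature.NumberTheory.Sieve.FriedlanderIwaniecPrimes (fourier2)
open Literature.NumberTheory.Sieve.LargeSieve (e sepCoeff sepWeight)
open PeterssonSplit (nearBoxes)

/-! ### §1. `levelLargePart` tools: congruence on the level set, completion of a convex cut inside -/

/-- `levelLargePart R Q F n a` depends only on `F` restricted to `Q`. [folklore] -/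
theorem levelLargePart_congr (R : ℕ) (Q : Finset ℕ) {F F' : ℕ → ℂ} (h : ∀ q ∈ Q, F q = F' q) {n : ℕ} (a : ZMod n) :
    levelLargePart R Q F n a = levelLargePart R Q F' n a := by
  rw [← sum_levelLargePart_singleton_mul Q F n R a, ← sum_levelLargePart_singleton_mul Q F' n R a]
  exact Finset.sum_congr rfl fun q hq ↦ by rw [h q hq]

/-- The exact expansion of a convex cut (leaf C `ite_convex_eq_sum_e_mul`) for ANY decidability instance.
[cite: Vaughan1980, Lemma 2 — derivation] -/
theorem ite_one_convex_eq_sum {P : ℕ} {p : ℕ → Prop} [∀ q, Decidable (p q)]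
    (hp : ∀ q₁ q₂ q₃ : ℕ, q₁ ∈ Finset.Icc 1 (P - 1) → q₃ ∈ Finset.Icc 1 (P - 1) → q₁ ≤ q₂ → q₂ ≤ q₃ → p q₁ → p q₃ → p q₂)
    {q : ℕ} (hq : q ∈ Finset.Icc 1 (P - 1)) :
    (if p q then (1 : ℂ) else 0) = ∑ k ∈ Finset.range P, e ((k : ℝ) * q / P) * convexCoeff p P k := by
  rw [← ite_convex_eq_sum_e_mul hp hq]
  by_cases h : p q <;> simp [h]

/-- **A convex cut inside `levelLargePart` is completed**: for `p` convex on `[1, P−1]` and `Q ⊆ [1, P−1]`,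
`levelLargePart R Q (𝟙[p]·F) n a = Σ_{k<P} convexCoeff p P k · levelLargePart R Q (e(k·/P)·F) n a`.
[cite: Vaughan1980, Lemma 2 — derivation] -/
theorem levelLargePart_ite_one_mul_convex {P : ℕ} {p : ℕ → Prop} [∀ q, Decidable (p q)]
    (hp : ∀ q₁ q₂ q₃ : ℕ, q₁ ∈ Finset.Icc 1 (P - 1) → q₃ ∈ Finset.Icc 1 (P - 1) → q₁ ≤ q₂ → q₂ ≤ q₃ → p q₁ → p q₃ → p q₂)
    (R : ℕ) (Q : Finset ℕ) (hQ : Q ⊆ Finset.Icc 1 (P - 1)) (F : ℕ → ℂ) {n : ℕ} (a : ZMod n) :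
    levelLargePart R Q (fun q ↦ (if p q then (1 : ℂ) else 0) * F q) n a =
      ∑ k ∈ Finset.range P, convexCoeff p P k * levelLargePart R Q (fun q ↦ e ((k : ℝ) * q / P) * F q) n a := by
  have hpt : ∀ q ∈ Q, (if p q then (1 : ℂ) else 0) * F q =
      ∑ k ∈ Finset.range P, convexCoeff p P k * (e ((k : ℝ) * q / P) * F q) := by
    intro q hq
    rw [ite_one_convex_eq_sum hp (hQ hq), Finset.sum_mul]
    exact Finset.sum_congr rfl fun k _ ↦ by ring
  rw [levelLargePart_congr R Q hpt a, levelLargePart_fun_sum Q R a]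
  exact Finset.sum_congr rfl fun k _ ↦ levelLargePart_const_mul Q R a _ _

/-- **Linearity bookkeeping**: a twist `ek`, a constant `E`, a level factor `ν`, a finite separated real sum
`Σ_w t(w)·u(q,w)` and a transform `Φ` inside `levelLargePart`:
`LLP(q ↦ ek q·(E·(ν q·(Σ_w t w·u q w)·Φ q))) = E·Σ_w t w·LLP(q ↦ ek q·ν q·u q w·Φ q)`. [folklore] -/
theorem levelLargePart_twist_sepSum (R : ℕ) (Q : Finset ℕ) {n : ℕ} (a : ZMod n) (ek ν Φ : ℕ → ℂ) (E : ℂ)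
    (W : Finset (ℕ × ℕ)) (t : ℕ × ℕ → ℝ) (u : ℕ → ℕ × ℕ → ℝ) :
    levelLargePart R Q (fun q ↦ ek q * (E * (ν q * ((∑ w ∈ W, t w * u q w : ℝ) : ℂ) * Φ q))) n a =
      E * ∑ w ∈ W, ((t w : ℝ) : ℂ) * levelLargePart R Q (fun q ↦ ek q * ν q * ((u q w : ℝ) : ℂ) * Φ q) n a := by
  have hpt : ∀ q ∈ Q, ek q * (E * (ν q * ((∑ w ∈ W, t w * u q w : ℝ) : ℂ) * Φ q)) =
      ∑ w ∈ W, (E * ((t w : ℝ) : ℂ)) * (ek q * ν q * ((u q w : ℝ) : ℂ) * Φ q) := by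
    intro q _
    push_cast
    rw [Finset.mul_sum, Finset.sum_mul, Finset.mul_sum, Finset.mul_sum]
    exact Finset.sum_congr rfl fun w _ ↦ by ring
  rw [levelLargePart_congr R Q hpt a, levelLargePart_fun_sum Q R a, Finset.mul_sum]
  refine Finset.sum_congr rfl fun w _ ↦ ?_
  rw [levelLargePart_const_mul Q R a, mul_assoc]

/-! ### §2. One member, separated -/

open Classical in
/-- **One member's `levelLargePart`, separated.** For a block of levels `Q ⊆ [1, P−1]` with `q` prime, `q ≥ 40`,
`|h₁| < q` on `Q`, `0 < Δ′`, `0 ≤ ε₀`, `l, m ≥ 1`, selector `D`, height `T`: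
`levelLargePart R Q (q ↦ 𝟙[¬(T < |s + ab/(q(r+1))|)]·coreLevelWeight D (coreHeight ε₀) Δ′ x q) n a
  = (𝟙[h₁ unit mod (r+1) ∧ h₁ ≠ 0]·𝟙[adm_x]·D_x) · Σ_{k<P} convexCoeff (coreRange_x ∧ window_x) P k ·
      Σ_{e∈3×3} t_{e₁}(l)t_{e₂}(m) · levelLargePart R Q (q ↦ e(kq/P)·(2q̂(q)2π/q)·u(q)^{e₁+e₂}·Φ̂_{q,x}) n a`.
[cite: KowalskiMichelVanderKam2000, §6 p. 19 — derivation; Vaughan1980, Lemma 2 — derivation] -/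
theorem levelLargePart_window_eq_separated {P : ℕ} (R : ℕ) (Q : Finset ℕ) (hQ : Q ⊆ Finset.Icc 1 (P - 1))
    {Δ' : ℝ} (hΔ : 0 < Δ') {ε₀ : ℝ} (hε₀ : 0 ≤ ε₀) (D : ℕ → ℕ → ℕ → ℕ → ℕ → ℕ × ℕ → ℤ → ℤ → ℂ) (T : ℕ)
    {r l m : ℕ} (hl : 1 ≤ l) (hm : 1 ≤ m) (d₁ d₂ : ℕ) (i : ℕ × ℕ) {h₁ : ℤ} (s : ℤ)
    (hQp : ∀ q ∈ Q, q.Prime ∧ 40 ≤ q ∧ |h₁| < q) {n : ℕ} (a : ZMod n) :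
    levelLargePart R Q (fun q ↦ if (T : ℝ) <
          |(s : ℝ) + ((((l / d₁ : ℕ) : ℤ) * (m / d₂ : ℕ) : ℤ) : ℝ) / ((q * (r + 1) : ℕ) : ℝ)| then 0 else
        coreLevelWeight D (coreHeight ε₀) Δ' r l m d₁ d₂ i h₁ s q) n a =
      ((if IsUnit ((h₁ : ℤ) : ZMod (r + 1)) ∧ h₁ ≠ 0 then (1 : ℂ) else 0) *
          (if ((switchGcd (r + 1) s h₁ : ℤ) ∣ ((l / d₁ : ℕ) : ℤ) * (m / d₂ : ℕ) ∧
              IsUnit (switchClass (r + 1) (((l / d₁ : ℕ) : ℤ) * (m / d₂ : ℕ)) s h₁)) then (1 : ℂ) else 0) *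
          D r l m d₁ d₂ i h₁ s) *
        ∑ k ∈ Finset.range P,
          convexCoeff (fun q ↦ coreRange Δ' ε₀ r l m d₁ d₂ i h₁ q ∧
              ¬ ((T : ℝ) < |(s : ℝ) + ((((l / d₁ : ℕ) : ℤ) * (m / d₂ : ℕ) : ℤ) : ℝ) / ((q * (r + 1) : ℕ) : ℝ)|)) P k *
            ∑ w ∈ Finset.range 3 ×ˢ Finset.range 3,
              ((trinomCoeff l w.1 * trinomCoeff m w.2 : ℝ) : ℂ) *
                levelLargePart R Q (fun q ↦ e ((k : ℝ) * q / P) * (2 * (qhat q : ℂ) * (2 * π / q)) *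
                    (((Real.log (qhat q ^ Δ'))⁻¹ ^ (w.1 + w.2) : ℝ) : ℂ) *
                  fourier2 (boxWeight q d₁ d₂ (l / d₁) (m / d₂) (r + 1) i) (h₁ / (q * (r + 1) : ℕ))
                    ((s : ℝ) / h₁ + (((l / d₁ : ℕ) : ℤ) * (m / d₂ : ℕ) : ℝ) / ((h₁ : ℝ) * (q * (r + 1) : ℕ)))) n a := by
  -- Step 1: the pointwise factorisation on `Q`
  set E : ℂ := (if IsUnit ((h₁ : ℤ) : ZMod (r + 1)) ∧ h₁ ≠ 0 then (1 : ℂ) else 0) *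
      (if ((switchGcd (r + 1) s h₁ : ℤ) ∣ ((l / d₁ : ℕ) : ℤ) * (m / d₂ : ℕ) ∧
          IsUnit (switchClass (r + 1) (((l / d₁ : ℕ) : ℤ) * (m / d₂ : ℕ)) s h₁)) then (1 : ℂ) else 0) *
      D r l m d₁ d₂ i h₁ s with hE
  have hpt : ∀ q ∈ Q, (if (T : ℝ) <
        |(s : ℝ) + ((((l / d₁ : ℕ) : ℤ) * (m / d₂ : ℕ) : ℤ) : ℝ) / ((q * (r + 1) : ℕ) : ℝ)| then 0 else
      coreLevelWeight D (coreHeight ε₀) Δ' r l m d₁ d₂ i h₁ s q) =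
      (if (coreRange Δ' ε₀ r l m d₁ d₂ i h₁ q ∧
          ¬ ((T : ℝ) < |(s : ℝ) + ((((l / d₁ : ℕ) : ℤ) * (m / d₂ : ℕ) : ℤ) : ℝ) / ((q * (r + 1) : ℕ) : ℝ)|))
        then (1 : ℂ) else 0) * (E * ((2 * (qhat q : ℂ) * (2 * π / q)) *
          ((∑ w ∈ Finset.range 3 ×ˢ Finset.range 3,
            trinomCoeff l w.1 * trinomCoeff m w.2 * (Real.log (qhat q ^ Δ'))⁻¹ ^ (w.1 + w.2) : ℝ) : ℂ) *
          fourier2 (boxWeight q d₁ d₂ (l / d₁) (m / d₂) (r + 1) i) (h₁ / (q * (r + 1) : ℕ))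
            ((s : ℝ) / h₁ + (((l / d₁ : ℕ) : ℤ) * (m / d₂ : ℕ) : ℝ) / ((h₁ : ℝ) * (q * (r + 1) : ℕ))))) := by
    intro q hq
    obtain ⟨hqp, hq40, hh⟩ := hQp q hq
    rw [window_coreLevelWeight_eq_factored hqp hq40 hΔ ε₀ D T hl hm d₁ d₂ i hh s, ← hE]
    ring
  rw [levelLargePart_congr R Q hpt a]
  -- Step 2: completion of the convex cut
  have hconv := levelConvex_and (P := P) (levelConvex_coreRange (P := P) hΔ.le hε₀ r l m d₁ d₂ i h₁)
    (levelConvex_window (P := P) (u := ((((l / d₁ : ℕ) : ℤ) * (m / d₂ : ℕ) : ℤ) : ℝ)) (by positivity)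
      (c := r + 1) (by omega) (s : ℝ) (T : ℝ))
  rw [levelLargePart_ite_one_mul_convex hconv R Q hQ _ a, Finset.mul_sum]
  refine Finset.sum_congr rfl fun k _ ↦ ?_
  -- Step 3: linearity in the level weight: the constant `E` and the trinomial sum come out
  have h3 := levelLargePart_twist_sepSum R Q a (fun q ↦ e ((k : ℝ) * q / P))
    (fun q ↦ 2 * (qhat q : ℂ) * (2 * π / q))
    (fun q ↦ fourier2 (boxWeight q d₁ d₂ (l / d₁) (m / d₂) (r + 1) i) (h₁ / (q * (r + 1) : ℕ))
      ((s : ℝ) / h₁ + (((l / d₁ : ℕ) : ℤ) * (m / d₂ : ℕ) : ℝ) / ((h₁ : ℝ) * (q * (r + 1) : ℕ))))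
    E (Finset.range 3 ×ˢ Finset.range 3) (fun w ↦ trinomCoeff l w.1 * trinomCoeff m w.2)
    (fun q w ↦ (Real.log (qhat q ^ Δ'))⁻¹ ^ (w.1 + w.2))
  beta_reduce at h3
  rw [h3]
  ring

end Summit.Parity.GeneralizedHardyLittlewood.Theorems.BeyondDiagonalBeatsQuarter.OffDiag
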